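/-
COR-CM (cell pub-hodgecm2, stage 2 of the Hodge ladder) — count-neutral KERNEL COMBINATORICS «mod-2 generation lifts to generation up to an ODD INDEX;
for 2-GROUPS the coinvariant floor φ₂(G,c) is attained by rank-four faces up to an odd index» (seat prover-pub-hodgecm2-b23-g45-0, binder prover b23, gen 45;
own census lane, claim HOME/INBOX.md).  Theorems only: no definition, no `decide`, no certificate, no named fact, no `sorry`; seat b09ʼs
`Census/CoinvariantFibre/Floor/TwoGroups` are used BY NAME.  `Interfaces.lean` (C1), every E term, B01, `Transposition/*`, `PortJoin/*`, `D2Bridge/*` untouched.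
HONEST FRAMING: `HC_CM` is NOT proved, here or anywhere in the tree; nothing here is a period, a count of record or a headline.
T5: n/a-class (no hypothesis binders beyond `c * c = 1`, `c ≠ 1`, `c` central, `IsPGroup 2 G`); checker: self, 2026-08-24.
-/
import Summits.HodgeConjecture.CorCM.Census.CoinvariantTwoGroups

/-!
# Odd-index generation: the mod-2 law lifts to ℤ up to an odd integer; for 2-groups `φ₂(G,c)` faces generate up to an odd index

SETTING of `Census/CoinvariantFibre.lean`: `G` finite, `c` a central involution `≠ 1`, `ℤ[types] = CMF G c →₀ ℤ`, the rank-four face relations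
`gfaceSet`, the pairs `pairSet`, the Hodge lattice `hodgeSpan = ℤ⟨faces⟩ + ℤ⟨pairs⟩` (the integer Hodge vectors), their reductions `faces2`,
`pair2`, `hodge2 ⊆ 𝔽₂[types]` and the coinvariant fibre dimension `φ₂(G,c) = fibreTwo`.  The census currency is `μ(G,c)`, the least number of
faces `S` with `hodgeSpan ≤ ℤ⟨pairs⟩ + ℤ⟨all base changes of S⟩`; seat b09 proved the floor `μ ≥ φ₂` for every `(G,c)`
(`Coinvariant.fibreTwo_le_card_of_faces`) and, for `G` a `2`-group, the MOD-2 law: `φ₂` faces generate `hodge2` modulo `pair2` over `𝔽₂[G]`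
(`Coinvariant.exists_faces_generate_of_isPGroup`).

THIS FILE lifts the mod-2 statement to the integers, as far as the prime `2` allows, for EVERY `(G,c)`:

* §1–§2  `hodgeSpan` is saturated (`mem_hodgeSpan_of_smul_mem`) and `red y = 0 ↔ y ∈ 2·ℤ[types]` (`exists_eq_two_smul_of_red_eq_zero`); every
  element of `𝔽₂⟨red X⟩` lifts to `ℤ⟨X⟩` (`exists_mem_span_red_eq`).
* §3 **LIFTING** (`exists_odd_smul_mem_of_hodge2_le`): if `S ⊆ hodgeSpan` is finite and its reduction generates mod `2`
  (`hodge2 ≤ pair2 + 𝔽₂[G]·red S`), then for some ODD integer `m`: `m · hodgeSpan ⊆ ℤ⟨pairs⟩ + ℤ[G]·S`.  Proof: `H = N + 2H` for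
  `N = ℤ⟨pairs⟩ + ℤ[G]·S ≤ H` (lift mod-2 witnesses, divide the even remainder by `2` inside the saturated `H`), then Nakayama over `ℤ` for the
  finitely generated module `H/N = 2·(H/N)` (`Submodule.exists_sub_one_mem_and_smul_eq_zero_of_fg_of_le_smul`).
* §4 **CONVERSELY** (`fibreTwo_le_card_of_odd_smul`): a finite `S ⊆ hodgeSpan` with `m · faces ⊆ ℤ⟨pairs⟩ + ℤ[G]·S` for an odd `m` has `|S| ≥ φ₂(G,c)` —
  the coinvariant floor also bounds odd-index generation (reduce mod `2`, `m ≡ 1`).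
* §5 **2-GROUPS** (`exists_gfaces_generate_oddIndex_of_isPGroup`, `isLeast_card_gfaces_oddIndex_of_isPGroup`): for `G` a `2`-group there are
  `φ₂(G,c)` FACES `S ⊆ gfaceSet` and an odd `m` with `m · hodgeSpan ⊆ ℤ⟨pairs⟩ + ℤ[G]·S`, and no smaller family of integer Hodge vectors achieves
  this for any odd `m`: the least cardinality is EXACTLY `φ₂(G,c)`.  Equivalently `hodgeSpan ⊗ ℤ₍₂₎` is generated by `φ₂` faces modulo pairs over
  `ℤ₍₂₎[G]`, so André-3ʼs law `μ = φ₂` holds for every `2`-group up to an odd index, and for a `2`-group `μ(G,c) = φ₂(G,c)` is equivalent to the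
  existence of `φ₂` fibre-spanning faces that also generate after inverting `2` (`generate_of_odd_smul_of_two_pow_smul`).

## References
* [Pohlmann1968] H. Pohlmann, Algebraic cycles on abelian varieties of complex multiplication type, Ann. of Math. 88 (1968), Thm 1.
* [Milne1999] J. S. Milne, Lefschetz motives and the Tate conjecture, Compositio Math. 117 (1999), Prop. 2.1, p. 54.
-/

namespace Summit.HodgeConjecture.CorCM.Census.OddIndex

open Finset
open Summit.HodgeConjecture.CorCM.Prior.AllgGroup.RfwfAllgGroup
open Summit.HodgeConjecture.CorCM.Census.BlockParity
open Summit.HodgeConjecture.CorCM.Census.Coinvariant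

variable {G : Type*} [Group G] [Fintype G] [DecidableEq G] (c : G)

/-! ## §1 Saturation of the Hodge lattice -/

/-- `typeSum` of an integer multiple. [folklore] -/
theorem typeSum_smul (n : ℤ) (y : CMF G c →₀ ℤ) (x : G) : typeSum G c (n • y) x = n * typeSum G c y x := by
  rw [map_smul, Pi.smul_apply, smul_eq_mul]

/-- **`hodgeSpan` is saturated in `ℤ[types]`** (central `c ≠ 1`): `n • y ∈ hodgeSpan`, `n ≠ 0` ⟹ `y ∈ hodgeSpan`. [folklore] -/
theorem mem_hodgeSpan_of_smul_mem (hc2 : c * c = 1) (hc1 : c ≠ 1) (hcen : ∀ x : G, x * c = c * x) {n : ℤ} (hn : n ≠ 0)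
    {y : CMF G c →₀ ℤ} (h : n • y ∈ hodgeSpan c hc2) : y ∈ hodgeSpan c hc2 := by
  obtain ⟨k, hk⟩ := exists_forall_typeSum_eq_of_mem_hodgeSpan c hc2 hcen h
  refine mem_hodgeSpan_of_forall_typeSum_eq c hc2 hc1 hcen (k := typeSum G c y 1) fun x => ?_
  have h1 := hk x
  have h2 := hk 1
  rw [typeSum_smul] at h1 h2
  exact mul_left_cancel₀ hn (h1.trans h2.symm)

/-- Pairs and base changes of a family of Hodge vectors span a sublattice of `hodgeSpan`. [folklore] -/
theorem psp_le_hodgeSpan (hc2 : c * c = 1) (hcen : ∀ x : G, x * c = c * x) (S : Finset (CMF G c →₀ ℤ))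
    (hS : (↑S : Set (CMF G c →₀ ℤ)) ⊆ hodgeSpan c hc2) :
    Submodule.span ℤ (pairSet c) ⊔ Submodule.span ℤ (translates c S) ≤ hodgeSpan c hc2 := by
  refine sup_le (Submodule.span_le.mpr fun _ ⟨Ψ, h⟩ => h ▸ pair_mem_hodgeSpan c hc2 Ψ) (Submodule.span_le.mpr ?_)
  rintro _ ⟨Q, s, hs, rfl⟩
  exact mapDomain_rt_mem_hodgeSpan c hc2 hcen Q (hS (mem_coe.mpr hs))

/-! ## §2 Reduction mod `2`: kernel and lifting of spans -/

/-- **`red y = 0` iff `y` is even**: a vector killed by reduction is `2 • z`. [folklore] -/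
theorem exists_eq_two_smul_of_red_eq_zero {y : CMF G c →₀ ℤ} (h : red c y = 0) : ∃ z : CMF G c →₀ ℤ, y = (2 : ℤ) • z := by
  refine ⟨Finsupp.mapRange (fun n : ℤ => n / 2) (by simp) y, Finsupp.ext fun Ψ => ?_⟩
  have hΨ : ((y Ψ : ℤ) : ZMod 2) = 0 := by
    have e := DFunLike.congr_fun h Ψ
    rwa [red_apply, Finsupp.mapRange_apply] at e
  rw [Finsupp.smul_apply, Finsupp.mapRange_apply, smul_eq_mul]
  exact (Int.mul_ediv_cancel' ((ZMod.intCast_zmod_eq_zero_iff_dvd _ 2).mp hΨ)).symm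

/-- A natural multiple in an `𝔽₂`-space is the cast multiple. [folklore] -/
theorem nsmul_eq_cast_smul {V : Type*} [AddCommGroup V] [Module (ZMod 2) V] (n : ℕ) (x : V) : n • x = (n : ZMod 2) • x :=
  (Nat.cast_smul_eq_nsmul (ZMod 2) n x).symm

/-- An odd integer multiple in an `𝔽₂`-space is the identity. [folklore] -/
theorem zsmul_eq_self_of_odd {V : Type*} [AddCommGroup V] [Module (ZMod 2) V] {m : ℤ} (hm : Odd m) (x : V) : m • x = x := by
  obtain ⟨k, rfl⟩ := hm
  have h2 : (2 : ℤ) • x = 0 := by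
    rw [← Int.cast_smul_eq_zsmul (ZMod 2) (2 : ℤ) x]
    have e : ((2 : ℤ) : ZMod 2) = 0 := by decide
    rw [e, zero_smul]
  rw [add_zsmul, one_zsmul, mul_comm, mul_zsmul, h2, smul_zero, zero_add]

/-- **Lifting spans through `red`**: every element of `𝔽₂⟨red X⟩` is the reduction of an element of `ℤ⟨X⟩`. [folklore] -/
theorem exists_mem_span_red_eq {X : Set (CMF G c →₀ ℤ)} {x : CMF G c →₀ ZMod 2} (hx : x ∈ Submodule.span (ZMod 2) (red c '' X)) :
    ∃ y ∈ Submodule.span ℤ X, red c y = x := by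
  induction hx using Submodule.span_induction with
  | mem x hx =>
    obtain ⟨y, hy, rfl⟩ := hx
    exact ⟨y, Submodule.subset_span hy, rfl⟩
  | zero => exact ⟨0, Submodule.zero_mem _, map_zero _⟩
  | add x x' _ _ hx hx' =>
    obtain ⟨y, hy, rfl⟩ := hx
    obtain ⟨y', hy', rfl⟩ := hx'
    exact ⟨y + y', Submodule.add_mem _ hy hy', map_add _ _ _⟩
  | smul a x _ hx =>
    obtain ⟨y, hy, rfl⟩ := hx
    refine ⟨a.val • y, Submodule.smul_of_tower_mem _ a.val hy, ?_⟩
    rw [map_nsmul, nsmul_eq_cast_smul, ZMod.natCast_zmod_val]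

/-- The translates mod `2` of `red S` are reductions of translates of `S`. [folklore] -/
theorem translates2_image_subset (S : Finset (CMF G c →₀ ℤ)) :
    translates2 c (S.image (red c)) ⊆ red c '' translates c S := by
  rintro _ ⟨Q, s₂, hs₂, rfl⟩
  obtain ⟨s, hs, rfl⟩ := mem_image.mp hs₂
  exact ⟨Finsupp.mapDomain (rt c Q) s, ⟨Q, s, hs, rfl⟩, red_mapDomain c (rt c Q) s⟩

/-- Conversely, reductions of translates of `S` are translates of `red S`. [folklore] -/
theorem image_translates_subset (S : Finset (CMF G c →₀ ℤ)) :
    red c '' translates c S ⊆ translates2 c (S.image (red c)) := by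
  rintro _ ⟨_, ⟨Q, s, hs, rfl⟩, rfl⟩
  exact ⟨Q, red c s, mem_image_of_mem _ hs, red_mapDomain c (rt c Q) s⟩

/-- **Lifting mod-2 witnesses**: every element of `pair2 + 𝔽₂[G]·red S` is the reduction of an element of `ℤ⟨pairs⟩ + ℤ[G]·S`. [folklore] -/
theorem exists_mem_psp_red_eq (S : Finset (CMF G c →₀ ℤ)) {x : CMF G c →₀ ZMod 2}
    (hx : x ∈ pair2 c ⊔ Submodule.span (ZMod 2) (translates2 c (S.image (red c)))) :
    ∃ n ∈ Submodule.span ℤ (pairSet c) ⊔ Submodule.span ℤ (translates c S), red c n = x := by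
  obtain ⟨a, ha, b, hb, rfl⟩ := Submodule.mem_sup.mp hx
  obtain ⟨p, hp, rfl⟩ := exists_mem_span_red_eq c ha
  obtain ⟨t, ht, rfl⟩ := exists_mem_span_red_eq c (Submodule.span_mono (translates2_image_subset c S) hb)
  exact ⟨p + t, Submodule.add_mem _ (Submodule.mem_sup_left hp) (Submodule.mem_sup_right ht), map_add _ _ _⟩

/-- **Reducing integral witnesses**: `red (ℤ⟨pairs⟩ + ℤ[G]·S) ⊆ pair2 + 𝔽₂[G]·red S`. [folklore] -/
theorem red_mem_psp2 (S : Finset (CMF G c →₀ ℤ)) {n : CMF G c →₀ ℤ}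
    (hn : n ∈ Submodule.span ℤ (pairSet c) ⊔ Submodule.span ℤ (translates c S)) :
    red c n ∈ pair2 c ⊔ Submodule.span (ZMod 2) (translates2 c (S.image (red c))) := by
  obtain ⟨p, hp, t, ht, rfl⟩ := Submodule.mem_sup.mp hn
  rw [map_add]
  exact Submodule.add_mem _ (Submodule.mem_sup_left (red_mem_pair2 c hp))
    (Submodule.mem_sup_right (Submodule.span_mono (image_translates_subset c S) (red_mem_span_of_mem_span c ht)))

/-! ## §3 Lifting: mod-2 generation ⟹ generation up to an odd integer -/

/-- **`H = N + 2H`.**  If the reduction of a finite family `S ⊆ hodgeSpan` generates mod `2`, every Hodge vector is a member of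
`N = ℤ⟨pairs⟩ + ℤ[G]·S` plus twice a Hodge vector (central `c ≠ 1`). [folklore] -/
theorem exists_eq_add_two_smul (hc2 : c * c = 1) (hc1 : c ≠ 1) (hcen : ∀ x : G, x * c = c * x) (S : Finset (CMF G c →₀ ℤ))
    (hS : (↑S : Set (CMF G c →₀ ℤ)) ⊆ hodgeSpan c hc2)
    (h2 : hodge2 c hc2 ≤ pair2 c ⊔ Submodule.span (ZMod 2) (translates2 c (S.image (red c))))
    {y : CMF G c →₀ ℤ} (hy : y ∈ hodgeSpan c hc2) :
    ∃ n ∈ Submodule.span ℤ (pairSet c) ⊔ Submodule.span ℤ (translates c S), ∃ z ∈ hodgeSpan c hc2, y = n + (2 : ℤ) • z := by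
  obtain ⟨n, hn, hred⟩ := exists_mem_psp_red_eq c S (h2 (red_mem_hodge2 c hc2 hy))
  obtain ⟨z, hz⟩ := exists_eq_two_smul_of_red_eq_zero c (y := y - n) (by rw [map_sub, hred, sub_self])
  refine ⟨n, hn, z, mem_hodgeSpan_of_smul_mem c hc2 hc1 hcen (n := 2) two_ne_zero ?_, by rw [← hz]; abel⟩
  rw [← hz]
  exact Submodule.sub_mem _ hy (psp_le_hodgeSpan c hc2 hcen S hS hn)

/-- `ℤ[types]` is a finite `ℤ`-module, so its sublattices are finitely generated. [folklore] -/
theorem fg_of_submodule (N : Submodule ℤ (CMF G c →₀ ℤ)) : N.FG :=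
  haveI : Module.Finite ℤ (CMF G c →₀ ℤ) := inferInstance
  IsNoetherian.noetherian N

/-- **LIFTING THEOREM.**  For a central involution `c ≠ 1` and a finite family `S` of integer Hodge vectors whose reduction generates the Hodge
lattice mod `2` modulo pairs over `𝔽₂[G]` (`hodge2 ≤ pair2 + 𝔽₂[G]·red S`), there is an ODD integer `m` with
`m · hodgeSpan ⊆ ℤ⟨pairs⟩ + ℤ[G]·S`: the family generates the Hodge lattice modulo pairs up to an odd index (Nakayama over `ℤ` applied to
`H/N = 2·(H/N)`). [folklore] -/
theorem exists_odd_smul_mem_of_hodge2_le (hc2 : c * c = 1) (hc1 : c ≠ 1) (hcen : ∀ x : G, x * c = c * x) (S : Finset (CMF G c →₀ ℤ))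
    (hS : (↑S : Set (CMF G c →₀ ℤ)) ⊆ hodgeSpan c hc2)
    (h2 : hodge2 c hc2 ≤ pair2 c ⊔ Submodule.span (ZMod 2) (translates2 c (S.image (red c)))) :
    ∃ m : ℤ, Odd m ∧ ∀ y ∈ hodgeSpan c hc2, m • y ∈ Submodule.span ℤ (pairSet c) ⊔ Submodule.span ℤ (translates c S) := by
  set N := Submodule.span ℤ (pairSet c) ⊔ Submodule.span ℤ (translates c S) with hN
  have hfg : (Submodule.map N.mkQ (hodgeSpan c hc2)).FG := (fg_of_submodule c (hodgeSpan c hc2)).map _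
  have hle : Submodule.map N.mkQ (hodgeSpan c hc2) ≤ (Ideal.span {(2 : ℤ)}) • Submodule.map N.mkQ (hodgeSpan c hc2) := by
    rintro _ ⟨y, hy, rfl⟩
    obtain ⟨n, hn, z, hz, rfl⟩ := exists_eq_add_two_smul c hc2 hc1 hcen S hS h2 hy
    have e : N.mkQ (n + (2 : ℤ) • z) = N.mkQ ((2 : ℤ) • z) :=
      (Submodule.Quotient.eq N).mpr (by rw [add_sub_cancel_right]; exact hn)
    rw [e, map_smul]
    exact Submodule.smul_mem_smul (Ideal.mem_span_singleton_self (2 : ℤ)) (Submodule.mem_map_of_mem hz)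
  obtain ⟨r, hr1, hr⟩ := Submodule.exists_sub_one_mem_and_smul_eq_zero_of_fg_of_le_smul (Ideal.span {(2 : ℤ)}) _ hfg hle
  refine ⟨r, ?_, fun y hy => ?_⟩
  · obtain ⟨k, hk⟩ := Ideal.mem_span_singleton'.mp hr1
    exact ⟨k, by linarith⟩
  · have h := hr _ (Submodule.mem_map_of_mem hy)
    rw [← map_smul, Submodule.mkQ_apply, Submodule.Quotient.mk_eq_zero] at h
    exact h

/-! ## §4 The floor for odd-index generation -/

/-- **Odd-index generation still costs `φ₂(G,c)` generators**: a finite family `S` of integer Hodge vectors with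
`m · faces ⊆ ℤ⟨pairs⟩ + ℤ[G]·S` for an ODD `m` has `|S| ≥ φ₂(G,c)` (reduce mod `2`, where `m ≡ 1`, and apply the mod-2 floor). [folklore] -/
theorem fibreTwo_le_card_of_odd_smul (hc2 : c * c = 1) (hcen : ∀ x : G, x * c = c * x) (S : Finset (CMF G c →₀ ℤ))
    (hS : (↑S : Set (CMF G c →₀ ℤ)) ⊆ hodgeSpan c hc2) {m : ℤ} (hm : Odd m)
    (h : ∀ y ∈ gfaceSet G c hc2, m • y ∈ Submodule.span ℤ (pairSet c) ⊔ Submodule.span ℤ (translates c S)) :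
    fibreTwo c hc2 ≤ S.card := by
  have hS2 : ((S.image (red c) : Finset (CMF G c →₀ ZMod 2)) : Set (CMF G c →₀ ZMod 2)) ⊆ hodge2 c hc2 := by
    intro x hx
    obtain ⟨s, hs, rfl⟩ := mem_image.mp (mem_coe.mp hx)
    exact red_mem_hodge2 c hc2 (hS hs)
  have hX : faces2 c hc2 ⊆ ↑(pair2 c ⊔ Submodule.span (ZMod 2) (translates2 c (S.image (red c)))) := by
    rintro _ ⟨f, hf, rfl⟩
    have e : red c f = red c (m • f) := by rw [map_zsmul, zsmul_eq_self_of_odd hm]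
    rw [SetLike.mem_coe, e]
    exact red_mem_psp2 c S (h f hf)
  exact (fibreTwo_le_card_two c hc2 hcen (S.image (red c)) hS2 hX).trans card_image_le

/-- **Mod-2 generation from odd-index generation** (the converse direction of §3, for the record). [folklore] -/
theorem hodge2_le_of_odd_smul (hc2 : c * c = 1) (S : Finset (CMF G c →₀ ℤ)) {m : ℤ} (hm : Odd m)
    (h : ∀ y ∈ hodgeSpan c hc2, m • y ∈ Submodule.span ℤ (pairSet c) ⊔ Submodule.span ℤ (translates c S)) :
    hodge2 c hc2 ≤ pair2 c ⊔ Submodule.span (ZMod 2) (translates2 c (S.image (red c))) := by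
  have hF : face2 c hc2 ≤ pair2 c ⊔ Submodule.span (ZMod 2) (translates2 c (S.image (red c))) := by
    rw [face2, Submodule.span_le]
    rintro _ ⟨f, hf, rfl⟩
    have e : red c f = red c (m • f) := by rw [map_zsmul, zsmul_eq_self_of_odd hm]
    rw [SetLike.mem_coe, e]
    exact red_mem_psp2 c S (h f (gfaceSet_subset_hodgeSpan c hc2 hf))
  exact sup_le hF le_sup_left

/-! ## §5 `2`-groups: `φ₂(G,c)` faces generate up to an odd index, and no fewer Hodge vectors do -/

/-- Lifting a finite family through an image: a finite `T ⊆ f '' X` is the bijective image of a finite `S ⊆ X`. [folklore] -/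
theorem exists_finset_image_eq {α β : Type*} [DecidableEq α] [DecidableEq β] (f : α → β) (X : Set α) (T : Finset β)
    (hT : (↑T : Set β) ⊆ f '' X) : ∃ S : Finset α, (↑S : Set α) ⊆ X ∧ S.image f = T ∧ S.card = T.card := by
  choose g hgX hgf using fun t : T => hT t.2
  have hinj : Function.Injective g := fun t t' h => Subtype.ext (by rw [← hgf t, ← hgf t', h])
  refine ⟨univ.image g, ?_, ?_, ?_⟩
  · intro x hx
    obtain ⟨t, -, rfl⟩ := mem_image.mp (mem_coe.mp hx)
    exact hgX t
  · ext b
    simp only [mem_image, mem_univ, true_and]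
    constructor
    · rintro ⟨_, ⟨t, rfl⟩, rfl⟩
      rw [hgf]; exact t.2
    · intro hb
      exact ⟨g ⟨b, hb⟩, ⟨⟨b, hb⟩, rfl⟩, hgf _⟩
  · rw [card_image_of_injective _ hinj, card_univ, Fintype.card_coe]

/-- **`φ₂(G,c)` FACES GENERATE UP TO AN ODD INDEX when `G` is a `2`-group.**  For `G` a `2`-group and `c` a central involution `≠ 1` there are
`φ₂(G,c)` rank-four face relations `S ⊆ gfaceSet` and an odd integer `m` with `m · hodgeSpan ⊆ ℤ⟨pairs⟩ + ℤ[G]·S` — André-3ʼs law `μ = φ₂` for every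
`2`-power order, integrally up to an odd index (b09ʼs mod-2 law + the lifting theorem). [folklore] -/
theorem exists_gfaces_generate_oddIndex_of_isPGroup (hG : IsPGroup 2 G) (hc2 : c * c = 1) (hc1 : c ≠ 1) (hcen : ∀ x : G, x * c = c * x) :
    ∃ S : Finset (CMF G c →₀ ℤ), (↑S : Set (CMF G c →₀ ℤ)) ⊆ gfaceSet G c hc2 ∧ S.card = fibreTwo c hc2 ∧
      ∃ m : ℤ, Odd m ∧ ∀ y ∈ hodgeSpan c hc2, m • y ∈ Submodule.span ℤ (pairSet c) ⊔ Submodule.span ℤ (translates c S) := by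
  classical
  obtain ⟨S₂, hS₂, hcard, hle⟩ := exists_faces_generate_of_isPGroup c hG hc2 hcen
  obtain ⟨S, hSX, himg, hScard⟩ := exists_finset_image_eq (red c) (gfaceSet G c hc2) S₂ hS₂
  have hS : (↑S : Set (CMF G c →₀ ℤ)) ⊆ hodgeSpan c hc2 := hSX.trans (gfaceSet_subset_hodgeSpan c hc2)
  refine ⟨S, hSX, hScard.trans hcard, exists_odd_smul_mem_of_hodge2_le c hc2 hc1 hcen S hS ?_⟩
  rw [himg]
  exact hle

/-- **THE ODD-INDEX LAW FOR `2`-GROUPS.**  For `G` a `2`-group and `c` a central involution `≠ 1`, the least cardinality of a family `S ⊆ gfaceSet` of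
rank-four face relations such that `m · hodgeSpan ⊆ ℤ⟨pairs⟩ + ℤ[G]·S` for some odd integer `m` is EXACTLY `φ₂(G,c) = fibreTwo c`. [folklore] -/
theorem isLeast_card_gfaces_oddIndex_of_isPGroup (hG : IsPGroup 2 G) (hc2 : c * c = 1) (hc1 : c ≠ 1) (hcen : ∀ x : G, x * c = c * x) :
    IsLeast {n : ℕ | ∃ S : Finset (CMF G c →₀ ℤ), (↑S : Set (CMF G c →₀ ℤ)) ⊆ gfaceSet G c hc2 ∧ S.card = n ∧
      ∃ m : ℤ, Odd m ∧ ∀ y ∈ hodgeSpan c hc2, m • y ∈ Submodule.span ℤ (pairSet c) ⊔ Submodule.span ℤ (translates c S)}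
      (fibreTwo c hc2) := by
  refine ⟨?_, ?_⟩
  · obtain ⟨S, hS, hcard, hm⟩ := exists_gfaces_generate_oddIndex_of_isPGroup c hG hc2 hc1 hcen
    exact ⟨S, hS, hcard, hm⟩
  · rintro n ⟨S, hS, rfl, m, hm, h⟩
    exact fibreTwo_le_card_of_odd_smul c hc2 hcen S (hS.trans (gfaceSet_subset_hodgeSpan c hc2)) hm
      fun y hy => h y (gfaceSet_subset_hodgeSpan c hc2 hy)

/-- **Odd-index generation by Hodge families is also floored by `φ₂`** (every `(G,c)`, central `c`): the `IsLeast` over families of integer Hodge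
vectors, attained by faces when `G` is a `2`-group. [folklore] -/
theorem isLeast_card_hodge_oddIndex_of_isPGroup (hG : IsPGroup 2 G) (hc2 : c * c = 1) (hc1 : c ≠ 1) (hcen : ∀ x : G, x * c = c * x) :
    IsLeast {n : ℕ | ∃ S : Finset (CMF G c →₀ ℤ), (↑S : Set (CMF G c →₀ ℤ)) ⊆ hodgeSpan c hc2 ∧ S.card = n ∧
      ∃ m : ℤ, Odd m ∧ ∀ y ∈ hodgeSpan c hc2, m • y ∈ Submodule.span ℤ (pairSet c) ⊔ Submodule.span ℤ (translates c S)}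
      (fibreTwo c hc2) := by
  refine ⟨?_, ?_⟩
  · obtain ⟨S, hS, hcard, hm⟩ := exists_gfaces_generate_oddIndex_of_isPGroup c hG hc2 hc1 hcen
    exact ⟨S, hS.trans (gfaceSet_subset_hodgeSpan c hc2), hcard, hm⟩
  · rintro n ⟨S, hS, rfl, m, hm, h⟩
    exact fibreTwo_le_card_of_odd_smul c hc2 hcen S hS hm fun y hy => h y (gfaceSet_subset_hodgeSpan c hc2 hy)

/-- **Killing the odd index.**  If a family generates up to an odd integer `m` AND up to a power of `2`, it generates:
`m · H ⊆ N` and `2^k · H ⊆ N` give `H ⊆ N` (Bézout).  For a `2`-group the first hypothesis is free for fibre-spanning faces (§3), so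
`μ(G,c) = φ₂(G,c)` reduces to generation after inverting `2`. [folklore] -/
theorem generate_of_odd_smul_of_two_pow_smul (hc2 : c * c = 1) (S : Finset (CMF G c →₀ ℤ)) {m : ℤ} (hm : Odd m) (k : ℕ)
    (hodd : ∀ y ∈ hodgeSpan c hc2, m • y ∈ Submodule.span ℤ (pairSet c) ⊔ Submodule.span ℤ (translates c S))
    (htwo : ∀ y ∈ hodgeSpan c hc2, ((2 : ℤ) ^ k) • y ∈ Submodule.span ℤ (pairSet c) ⊔ Submodule.span ℤ (translates c S)) :
    hodgeSpan c hc2 ≤ Submodule.span ℤ (pairSet c) ⊔ Submodule.span ℤ (translates c S) := by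
  intro y hy
  have hcop : IsCoprime m ((2 : ℤ) ^ k) := by
    refine IsCoprime.pow_right ?_
    obtain ⟨j, rfl⟩ := hm
    exact ⟨1, -j, by ring⟩
  obtain ⟨a, b, hab⟩ := hcop
  have e : y = a • (m • y) + b • (((2 : ℤ) ^ k) • y) := by
    rw [smul_smul, smul_smul, ← add_smul, hab, one_smul]
  rw [e]
  exact Submodule.add_mem _ (Submodule.smul_mem _ a (hodd y hy)) (Submodule.smul_mem _ b (htwo y hy))

end Summit.HodgeConjecture.CorCM.Census.OddIndex
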